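import Summits.BirchSwinnertonDyer.Rank1Residual.Additive.X3BranchLayerCyclotomicValuation
import Summits.BirchSwinnertonDyer.Rank1Residual.Additive.X3BranchLayerKummerData
import Summits.BirchSwinnertonDyer.Rank1Residual.Additive.X3BranchKummerLayerTwisted
import HarnessLib

/-!
# X3 degenerate road, brick T1: the layers of the cyclotomic `ℤ_p`-extension inside `ℚ(ζ_{p^{N+1}})` —
# Galois bookkeeping (cell `bsd-eis`, seat `bsd-eis-x3` gen 9; route K1 `AdditiveBranchIMC`, crux
# `GordTwoRankZeroOffCaseOne` — supports only; THEOREMS ONLY)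

HONEST FRAMING (`run/shared/lean/pub/bsd-eis/README.md` §4): the programme's target of record is the full
Birch–Swinnerton-Dyer formula for every `E/ℚ` of analytic rank `≤ 1`; this file is Galois bookkeeping for
the T-side half `3^{τ(S₀)} ≤ #H¹(ℚ_Σ/ℚ_∞, Φ₀)` of the CLASS-LEVEL count of `x3-MEMO-11.md` on the
DEGENERATE X3♯(G-ord) rows at `p = 3`.  `Γ_ℚ`-internally, for a cyclotomic `κ` and `p` odd:
* `IsCyclotomic.smul_eq_self_of_mem_layerSubgroup` — `σ ∈ Gal(ℚ̄/ℚ_N)` fixing `ζ_p = ζ^{p^N}` fixes the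
  primitive `p^{N+1}`-th root of unity `ζ` (`ℚ_N(ζ_p) = ℚ(ζ_{p^{N+1}})` by degrees), hence all of
  `ℚ(ζ)` (`…smul_eq_self_of_mem_adjoin`); conversely (`mem_layerSubgroup_of_smul_eq_self`);
* `exists_pow_mul_of_mem_layerSubgroup_succ` — `Gal(ℚ̄/ℚ_{N+1}) = Gal(ℚ̄/ℚ_N)^p · Gal(ℚ̄/ℚ_∞)`, so an
  additive `ℤ/p`-valued character of `Gal(ℚ̄/ℚ_N)` dying on `Gal(ℚ̄/ℚ_∞)` dies on `Gal(ℚ̄/ℚ_{N+1})`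
  (`addChar_eq_zero_of_mem_layerSubgroup_succ`);
* (`p = 3`) `exists_generator_stab_zeta_three` — a `g ∈ Gal(ℚ̄/ℚ_N(ζ₃)) ∖ Gal(ℚ̄/ℚ_{N+1})` with
  `Gal(ℚ̄/ℚ_N(ζ₃)) = ⋃_i g^i · Gal(ℚ̄/ℚ_{N+1}(ζ₃))`, and `exists_mem_layerSubgroup_smul_zeta_three_ne` —
  an element of `Gal(ℚ̄/ℚ_N)` moving `ζ₃`.
Nothing is booked here.  References: [Washington1997] §13.1, Prop. 2.3; [SerreLocalFields1979] Ch. X §3.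
-/

set_option autoImplicit false

noncomputable section

open scoped Classical NumberField

namespace Literature.NumberTheory.EllipticCurves.ZpExtension

open Field NumberField Literature.NumberTheory.GaloisRepresentations
  Summit.BirchSwinnertonDyer.Rank1Residual.Additive

variable {p : ℕ} [hp : Fact p.Prime] {κ : ZpExtension ℚ p}

/-- **`σ ∈ Gal(ℚ̄/ℚ_N)` fixing `ζ^{p^N}` fixes the primitive `p^{N+1}`-th root of unity `ζ`** (`κ`
cyclotomic, `p` odd): `ℚ_N ⊔ ℚ(ζ^{p^N}) = ℚ(ζ)` inside `ℚ̄`, both sides having degree `p^N (p − 1)`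
(`[ℚ_N : ℚ] = p^N` and `[ℚ(ζ_p) : ℚ] = p − 1` are coprime). [cite: Washington1997, §13.1 and Prop. 2.3] -/
theorem IsCyclotomic.smul_eq_self_of_mem_layerSubgroup (hκ : κ.IsCyclotomic) (hp2 : p ≠ 2) (N : ℕ)
    {ζ : AlgebraicClosure ℚ} (hζ : IsPrimitiveRoot ζ (p ^ (N + 1))) {σ : absoluteGaloisGroup ℚ}
    (hσ : σ ∈ κ.layerSubgroup N) (hσp : σ • ζ ^ p ^ N = ζ ^ p ^ N) : σ • ζ = ζ := by
  haveI : @IsGalois ℚ _ (AlgebraicClosure ℚ) _ (AlgebraicClosure.instAlgebra ℚ) :=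
    @IsAlgClosure.isGalois ℚ (AlgebraicClosure ℚ) _ _ (AlgebraicClosure.instAlgebra ℚ) inferInstance
      inferInstance
  haveI : @Algebra.IsIntegral ℚ (AlgebraicClosure ℚ) _ _ (AlgebraicClosure.instAlgebra ℚ) :=
    Algebra.isAlgebraic_iff_isIntegral.mp (AlgebraicClosure.isAlgebraic ℚ)
  haveI : NeZero (p ^ (N + 1)) := ⟨pow_ne_zero _ hp.out.ne_zero⟩
  haveI : NeZero p := ⟨hp.out.ne_zero⟩
  haveI : FiniteDimensional ℚ (κ.layer N) := κ.finiteDimensional_layer_holds N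
  set L := @IntermediateField.adjoin ℚ _ (AlgebraicClosure ℚ) _ (AlgebraicClosure.instAlgebra ℚ) {ζ}
    with hL
  set F := @IntermediateField.adjoin ℚ _ (AlgebraicClosure ℚ) _ (AlgebraicClosure.instAlgebra ℚ)
    {ζ ^ p ^ N} with hF
  have hζp : IsPrimitiveRoot (ζ ^ p ^ N) p := hζ.pow (pow_pos hp.out.pos _) (pow_succ p N)
  haveI : IsCyclotomicExtension {p ^ (N + 1)} ℚ L :=
    IsPrimitiveRoot.intermediateField_adjoin_isCyclotomicExtension (K := ℚ) hζ
  haveI : IsCyclotomicExtension {p} ℚ F :=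
    IsPrimitiveRoot.intermediateField_adjoin_isCyclotomicExtension (K := ℚ) hζp
  haveI : FiniteDimensional ℚ L :=
    IntermediateField.adjoin.finiteDimensional (Algebra.IsIntegral.isIntegral ζ)
  haveI : FiniteDimensional ℚ F :=
    IntermediateField.adjoin.finiteDimensional (Algebra.IsIntegral.isIntegral (ζ ^ p ^ N))
  have hLdeg : Module.finrank ℚ L = p ^ N * (p - 1) := by
    rw [IsCyclotomicExtension.finrank (n := p ^ (N + 1)) L
        (Polynomial.cyclotomic.irreducible_rat (pow_pos hp.out.pos (N + 1))),
      Nat.totient_prime_pow_succ hp.out]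
  have hFdeg : Module.finrank ℚ F = p - 1 := by
    rw [IsCyclotomicExtension.finrank (n := p) F (Polynomial.cyclotomic.irreducible_rat hp.out.pos),
      Nat.totient_prime hp.out]
  have hKdeg : Module.finrank ℚ (κ.layer N) = p ^ N := κ.finrank_layer_holds N
  have hKL : κ.layer N ≤ L := hκ.layer_le_adjoin hp2 N hζ
  have hFL : F ≤ L :=
    IntermediateField.adjoin_simple_le_iff.mpr (pow_mem (IntermediateField.mem_adjoin_simple_self ℚ ζ) _)
  set M := κ.layer N ⊔ F with hM
  have hML : M ≤ L := sup_le hKL hFL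
  haveI : FiniteDimensional ℚ M := IntermediateField.finiteDimensional_sup _ _
  -- degrees: `p^N (p-1) ∣ [ℚ_N ⊔ F : ℚ] ≤ [L : ℚ] = p^N (p-1)`
  have h1 : p ^ N ∣ Module.finrank ℚ M := by
    rw [← hKdeg]
    exact Dvd.intro _ (IntermediateField.finrank_bot_mul_relfinrank (le_sup_left (b := F)))
  have h2 : p - 1 ∣ Module.finrank ℚ M := by
    rw [← hFdeg]
    exact Dvd.intro _ (IntermediateField.finrank_bot_mul_relfinrank (le_sup_right (a := κ.layer N)))
  have hcop : Nat.Coprime (p ^ N) (p - 1) := by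
    refine Nat.Coprime.pow_left N ?_
    exact (Nat.coprime_self_sub_right hp.out.one_lt.le).mpr (Nat.coprime_one_right p)
  have h3 : p ^ N * (p - 1) ∣ Module.finrank ℚ M :=
    hcop.mul_dvd_of_dvd_of_dvd h1 h2
  have h4 : Module.finrank ℚ L ≤
      Module.finrank ℚ M := by
    rw [hLdeg]
    exact Nat.le_of_dvd Module.finrank_pos h3
  have hMeqL : M = L := IntermediateField.eq_of_le_of_finrank_le hML h4
  -- `σ` fixes `ℚ_N` and `F` pointwise, hence `L ∋ ζ`
  have hfixK : absoluteGaloisGroup.toAlgEquiv ℚ σ ∈ (κ.layer N).fixingSubgroup := by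
    rw [IntermediateField.mem_fixingSubgroup_iff]
    intro x hx
    exact (mem_layer_iff_forall_smul_eq κ N x).mp hx σ hσ
  have hfixF : absoluteGaloisGroup.toAlgEquiv ℚ σ ∈ F.fixingSubgroup := by
    rw [IntermediateField.mem_fixingSubgroup_iff]
    intro x hx
    have hle : F ≤ IntermediateField.fixedField (Subgroup.zpowers (absoluteGaloisGroup.toAlgEquiv ℚ σ)) := by
      rw [hF, IntermediateField.adjoin_simple_le_iff, IntermediateField.mem_fixedField_iff]
      intro f hf
      obtain ⟨k, rfl⟩ := Subgroup.mem_zpowers_iff.mp hf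
      have hσp' : (absoluteGaloisGroup.toAlgEquiv ℚ σ) (ζ ^ p ^ N) = ζ ^ p ^ N := hσp
      have hnat : ∀ n : ℕ, ((absoluteGaloisGroup.toAlgEquiv ℚ σ) ^ n) (ζ ^ p ^ N) = ζ ^ p ^ N :=
        fun n => by rw [AlgEquiv.coe_pow]; exact Function.IsFixedPt.iterate hσp' n
      obtain ⟨n, rfl | rfl⟩ := Int.eq_nat_or_neg k
      · rw [zpow_natCast]; exact hnat n
      · rw [zpow_neg, zpow_natCast, AlgEquiv.aut_inv, AlgEquiv.symm_apply_eq]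
        exact (hnat n).symm
    exact (IntermediateField.mem_fixedField_iff _ x).mp (hle hx) _ (Subgroup.mem_zpowers _)
  have hfixM : absoluteGaloisGroup.toAlgEquiv ℚ σ ∈
      M.fixingSubgroup := by
    rw [IntermediateField.fixingSubgroup_sup]
    exact ⟨hfixK, hfixF⟩
  have hζM : ζ ∈ M := by
    rw [hMeqL]; exact IntermediateField.mem_adjoin_simple_self ℚ ζ
  exact (IntermediateField.mem_fixingSubgroup_iff _ _).mp hfixM ζ hζM

/-- An automorphism fixing `ζ` fixes `ℚ(ζ)` pointwise. [folklore] -/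
theorem smul_eq_self_of_mem_adjoin_simple {ζ x : AlgebraicClosure ℚ} {σ : absoluteGaloisGroup ℚ}
    (hσ : σ • ζ = ζ)
    (hx : x ∈ @IntermediateField.adjoin ℚ _ (AlgebraicClosure ℚ) _ (AlgebraicClosure.instAlgebra ℚ) {ζ}) :
    σ • x = x := by
  have hσ' : (absoluteGaloisGroup.toAlgEquiv ℚ σ) ζ = ζ := hσ
  have hnat : ∀ n : ℕ, ((absoluteGaloisGroup.toAlgEquiv ℚ σ) ^ n) ζ = ζ :=
    fun n => by rw [AlgEquiv.coe_pow]; exact Function.IsFixedPt.iterate hσ' n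
  have hle : @IntermediateField.adjoin ℚ _ (AlgebraicClosure ℚ) _ (AlgebraicClosure.instAlgebra ℚ) {ζ} ≤
      IntermediateField.fixedField (Subgroup.zpowers (absoluteGaloisGroup.toAlgEquiv ℚ σ)) := by
    rw [IntermediateField.adjoin_simple_le_iff, IntermediateField.mem_fixedField_iff]
    intro f hf
    obtain ⟨k, rfl⟩ := Subgroup.mem_zpowers_iff.mp hf
    obtain ⟨n, rfl | rfl⟩ := Int.eq_nat_or_neg k
    · rw [zpow_natCast]; exact hnat n
    · rw [zpow_neg, zpow_natCast, AlgEquiv.aut_inv, AlgEquiv.symm_apply_eq]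
      exact (hnat n).symm
  exact (IntermediateField.mem_fixedField_iff _ x).mp (hle hx) _ (Subgroup.mem_zpowers _)

/-- **`σ ∈ Gal(ℚ̄/ℚ_N)` fixing `ζ^{p^N}` fixes `ℚ(ζ)` pointwise**, `ζ` a primitive `p^{N+1}`-th root of
unity (`κ` cyclotomic, `p` odd). [cite: Washington1997, §13.1] -/
theorem IsCyclotomic.smul_eq_self_of_mem_adjoin (hκ : κ.IsCyclotomic) (hp2 : p ≠ 2) (N : ℕ)
    {ζ : AlgebraicClosure ℚ} (hζ : IsPrimitiveRoot ζ (p ^ (N + 1))) {σ : absoluteGaloisGroup ℚ}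
    (hσ : σ ∈ κ.layerSubgroup N) (hσp : σ • ζ ^ p ^ N = ζ ^ p ^ N) {x : AlgebraicClosure ℚ}
    (hx : x ∈ @IntermediateField.adjoin ℚ _ (AlgebraicClosure ℚ) _ (AlgebraicClosure.instAlgebra ℚ) {ζ}) :
    σ • x = x :=
  smul_eq_self_of_mem_adjoin_simple (hκ.smul_eq_self_of_mem_layerSubgroup hp2 N hζ hσ hσp) hx

/-- Conversely **an automorphism fixing a primitive `p^{N+1}`-th root of unity lies in `Gal(ℚ̄/ℚ_N)`**
(`κ` cyclotomic, `p` odd; `rootsOfUnityFixer_le_layerSubgroup`). [cite: Washington1997, §13.1] -/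
theorem IsCyclotomic.mem_layerSubgroup_of_smul_eq_self (hκ : κ.IsCyclotomic) (hp2 : p ≠ 2) (N : ℕ)
    {ζ : AlgebraicClosure ℚ} (hζ : IsPrimitiveRoot ζ (p ^ (N + 1))) {σ : absoluteGaloisGroup ℚ}
    (h : σ • ζ = ζ) : σ ∈ κ.layerSubgroup N := by
  haveI : NeZero (p ^ (N + 1)) := ⟨pow_ne_zero _ hp.out.ne_zero⟩
  refine hκ.rootsOfUnityFixer_le_layerSubgroup hp2 N ?_
  intro t ht
  obtain ⟨j, -, rfl⟩ := hζ.eq_pow_of_pow_eq_one ht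
  rw [smul_pow', h]

/-- **`Gal(ℚ̄/K_{N+1}) = Gal(ℚ̄/K_N)^p · Gal(ℚ̄/K_∞)`** for any `ℤ_p`-extension: if `κ(g) ∈ p^{N+1}ℤ_p`,
then `g = g₁^p h` with `κ(g₁) ∈ p^N ℤ_p` and `κ(h) = 0` (`κ` is surjective). [folklore] -/
theorem exists_pow_mul_of_mem_layerSubgroup_succ {K : Type} [Field K] (κ' : ZpExtension K p) {N : ℕ}
    {g : absoluteGaloisGroup K} (hg : g ∈ κ'.layerSubgroup (N + 1)) :
    ∃ g₁ ∈ κ'.layerSubgroup N, ∃ h ∈ κ'.kerSubgroup, g = g₁ ^ p * h := by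
  rw [mem_layerSubgroup] at hg
  obtain ⟨y, hy⟩ := hg
  obtain ⟨g₁, hg₁⟩ := κ'.surjective (Multiplicative.ofAdd ((p : ℤ_[p]) ^ N * y))
  have hg₁' : κ' g₁ = Multiplicative.ofAdd ((p : ℤ_[p]) ^ N * y) := hg₁
  refine ⟨g₁, ?_, (g₁ ^ p)⁻¹ * g, ?_, by group⟩
  · rw [mem_layerSubgroup, hg₁', toAdd_ofAdd]
    exact Dvd.intro y rfl
  · rw [mem_kerSubgroup, map_mul, map_inv, map_pow, hg₁', ← ofAdd_nsmul, nsmul_eq_mul]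
    apply_fun Multiplicative.toAdd using Multiplicative.toAdd.injective
    rw [toAdd_mul, toAdd_inv, toAdd_ofAdd, toAdd_one, hy]
    ring

/-- **An additive `ℤ/p`-valued character of `Gal(ℚ̄/K_N)` that dies on `Gal(ℚ̄/K_∞)` dies on
`Gal(ℚ̄/K_{N+1})`** (it factors through `Gal(K_∞/K_N) ≅ ℤ_p`, and `p · (ℤ/p) = 0`). [folklore] -/
theorem addChar_eq_zero_of_mem_layerSubgroup_succ {K : Type} [Field K] (κ' : ZpExtension K p) {N : ℕ}
    (ψ : absoluteGaloisGroup K → ZMod p)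
    (hadd : ∀ a ∈ κ'.layerSubgroup N, ∀ a' ∈ κ'.layerSubgroup N, ψ (a * a') = ψ a + ψ a')
    (hker : ∀ h ∈ κ'.kerSubgroup, ψ h = 0) {g : absoluteGaloisGroup K}
    (hg : g ∈ κ'.layerSubgroup (N + 1)) : ψ g = 0 := by
  obtain ⟨g₁, hg₁, h, hh, rfl⟩ := exists_pow_mul_of_mem_layerSubgroup_succ κ' hg
  have hpow : ∀ n : ℕ, ψ (g₁ ^ n) = n • ψ g₁ := by
    intro n
    induction n with
    | zero =>
      have h1 : ψ 1 = ψ 1 + ψ 1 := by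
        have := hadd 1 (one_mem _) 1 (one_mem _)
        rwa [mul_one] at this
      rw [pow_zero, zero_smul]
      have : ψ 1 + ψ 1 - ψ 1 = ψ 1 - ψ 1 := by rw [← h1]
      simpa using this
    | succ n ih =>
      rw [pow_succ, hadd _ (pow_mem hg₁ n) _ hg₁, ih, succ_nsmul]
  rw [hadd _ (pow_mem hg₁ p) _ (κ'.kerSubgroup_le_layerSubgroup N hh), hker h hh, add_zero, hpow,
    nsmul_eq_mul, ZMod.natCast_self, zero_mul]

/-! ### `p = 3`: a generator modulo `Gal(ℚ̄/ℚ_{N+1})` fixing `ζ₃`, and an element moving `ζ₃` -/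

/-- **A generator of `Gal(ℚ̄/ℚ_N(ζ₃))` modulo `Gal(ℚ̄/ℚ_{N+1}(ζ₃))`** for a `ℤ₃`-extension `κ` of `ℚ`:
some `g ∈ Gal(ℚ̄/ℚ_N)` fixing `ζ₃`, not in `Gal(ℚ̄/ℚ_{N+1})`, with every `σ ∈ Gal(ℚ̄/ℚ_N)` fixing `ζ₃`
of the form `g^i h`, `h ∈ Gal(ℚ̄/ℚ_{N+1})` fixing `ζ₃` (take `g = σ₀²`, `κ(σ₀) = 3^N/2`).
[cite: Washington1997, §13.1] -/
theorem exists_generator_stab_zeta_three (κ₃ : ZpExtension ℚ 3) (N : ℕ) {ζ₃ : AlgebraicClosure ℚ}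
    (hζ₃ : IsPrimitiveRoot ζ₃ 3) :
    ∃ g ∈ κ₃.layerSubgroup N, g • ζ₃ = ζ₃ ∧ g ∉ κ₃.layerSubgroup (N + 1) ∧
      ∀ σ ∈ κ₃.layerSubgroup N, σ • ζ₃ = ζ₃ →
        ∃ (i : ℕ) (h : absoluteGaloisGroup ℚ), h ∈ κ₃.layerSubgroup (N + 1) ∧ h • ζ₃ = ζ₃ ∧
          σ = g ^ i * h := by
  haveI : Fact (Nat.Prime 3) := ⟨Nat.prime_three⟩
  have isUnit_two_padicInt_three : IsUnit (2 : ℤ_[3]) := by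
    rw [PadicInt.isUnit_iff]
    refine le_antisymm (PadicInt.norm_le_one _) (not_lt.mp fun h => ?_)
    have h' := (PadicInt.norm_int_lt_one_iff_dvd (p := 3) 2).mp (by exact_mod_cast h)
    omega
  obtain ⟨u, hu⟩ := isUnit_two_padicInt_three
  obtain ⟨σ₀, hσ₀⟩ := κ₃.surjective (Multiplicative.ofAdd (((3 : ℕ) : ℤ_[3]) ^ N * (↑u⁻¹ : ℤ_[3])))
  have hσ₀' : κ₃ σ₀ = Multiplicative.ofAdd (((3 : ℕ) : ℤ_[3]) ^ N * (↑u⁻¹ : ℤ_[3])) := hσ₀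
  have hsq : ∀ ρ : absoluteGaloisGroup ℚ, (ρ ^ 2) • ζ₃ = ζ₃ := fun ρ => by
    rw [pow_two, mul_smul]
    rcases KummerLayerTwisted.smul_zeta_eq_or hζ₃ ρ with h | h
    · rw [h, h]
    · rw [h, smul_pow', h, ← pow_mul]
      have h3 : ζ₃ ^ 3 = 1 := hζ₃.pow_eq_one
      calc ζ₃ ^ (2 * 2) = ζ₃ ^ 3 * ζ₃ := by ring
        _ = ζ₃ := by rw [h3, one_mul]
  have hg : Multiplicative.toAdd (κ₃ (σ₀ ^ 2)) = ((3 : ℕ) : ℤ_[3]) ^ N := by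
    rw [map_pow, hσ₀', ← ofAdd_nsmul, toAdd_ofAdd, nsmul_eq_mul, Nat.cast_ofNat, ← hu]
    rw [mul_left_comm, Units.mul_inv, mul_one]
  have hgpow : ∀ n : ℕ, Multiplicative.toAdd (κ₃ ((σ₀ ^ 2) ^ n)) = n * ((3 : ℕ) : ℤ_[3]) ^ N := by
    intro n
    rw [map_pow, toAdd_pow, hg, nsmul_eq_mul]
  have hfixpow : ∀ n : ℕ, ((σ₀ ^ 2) ^ n) • ζ₃ = ζ₃ := fun n => by
    induction n with
    | zero => rw [pow_zero, one_smul]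
    | succ n ih => rw [pow_succ, mul_smul, hsq σ₀, ih]
  have h3ne : ((3 : ℕ) : ℤ_[3]) ^ N ≠ 0 := pow_ne_zero _ (by exact_mod_cast Nat.prime_three.ne_zero)
  refine ⟨σ₀ ^ 2, ?_, hsq σ₀, ?_, ?_⟩
  · rw [mem_layerSubgroup, hg]
  · rw [mem_layerSubgroup, hg, pow_succ]
    rintro ⟨c, hc⟩
    have h31 : (1 : ℤ_[3]) = ((3 : ℕ) : ℤ_[3]) * c :=
      mul_left_cancel₀ h3ne (by rw [mul_one, ← mul_assoc]; exact hc)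
    have hlt : ‖(((3 : ℕ) : ℤ) : ℤ_[3])‖ < 1 :=
      (PadicInt.norm_int_lt_one_iff_dvd (p := 3) ((3 : ℕ) : ℤ)).mpr (dvd_refl _)
    have h1 : ‖(1 : ℤ_[3])‖ < 1 := by
      calc ‖(1 : ℤ_[3])‖ = ‖((3 : ℕ) : ℤ_[3]) * c‖ := by rw [← h31]
        _ = ‖((3 : ℕ) : ℤ_[3])‖ * ‖c‖ := norm_mul _ _
        _ ≤ ‖((3 : ℕ) : ℤ_[3])‖ * 1 := by gcongr; exact PadicInt.norm_le_one c
        _ < 1 := by rw [mul_one]; exact_mod_cast hlt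
    rw [norm_one] at h1
    exact lt_irrefl _ h1
  · intro σ hσ hσζ
    rw [mem_layerSubgroup] at hσ
    obtain ⟨y, hy⟩ := hσ
    refine ⟨(PadicInt.toZMod y).val, ((σ₀ ^ 2) ^ (PadicInt.toZMod y).val)⁻¹ * σ, ?_, ?_, by group⟩
    · rw [mem_layerSubgroup, map_mul, map_inv, toAdd_mul, toAdd_inv, hgpow, hy, ZMod.natCast_val]
      have hspec := PadicInt.toZMod_spec y
      rw [PadicInt.maximalIdeal_eq_span_p, Ideal.mem_span_singleton] at hspec
      obtain ⟨c, hc⟩ := hspec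
      refine ⟨c, ?_⟩
      rw [pow_succ, mul_assoc, ← hc]
      ring
    · rw [mul_smul, hσζ, inv_smul_eq_iff, hfixpow]

/-- `ρ²` fixes a primitive cube root of unity, for every `ρ ∈ Γ_ℚ`. [folklore] -/
theorem sq_smul_zeta_three {ζ₃ : AlgebraicClosure ℚ} (hζ₃ : IsPrimitiveRoot ζ₃ 3)
    (ρ : absoluteGaloisGroup ℚ) : (ρ ^ 2) • ζ₃ = ζ₃ := by
  rw [pow_two, mul_smul]
  rcases KummerLayerTwisted.smul_zeta_eq_or hζ₃ ρ with h | h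
  · rw [h, h]
  · rw [h, smul_pow', h, ← pow_mul]
    have h3 : ζ₃ ^ 3 = 1 := hζ₃.pow_eq_one
    calc ζ₃ ^ (2 * 2) = ζ₃ ^ 3 * ζ₃ := by ring
      _ = ζ₃ := by rw [h3, one_mul]

/-- **Some element of `Gal(ℚ̄/ℚ_N)` moves `ζ₃`** (`ζ₃ ∉ ℚ`; twist a mover `ρ` by `σ₁²` with
`κ(σ₁) = −κ(ρ)/2`). [cite: Washington1997, §13.1] -/
theorem exists_mem_layerSubgroup_smul_zeta_three_ne (κ₃ : ZpExtension ℚ 3) (N : ℕ)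
    {ζ₃ : AlgebraicClosure ℚ} (hζ₃ : IsPrimitiveRoot ζ₃ 3) :
    ∃ c ∈ κ₃.layerSubgroup N, c • ζ₃ ≠ ζ₃ := by
  haveI : Fact (Nat.Prime 3) := ⟨Nat.prime_three⟩
  haveI : @IsGalois ℚ _ (AlgebraicClosure ℚ) _ (AlgebraicClosure.instAlgebra ℚ) :=
    @IsAlgClosure.isGalois ℚ (AlgebraicClosure ℚ) _ _ (AlgebraicClosure.instAlgebra ℚ) inferInstance
      inferInstance
  -- `ζ₃ ∉ ℚ`
  have hnotbot : ζ₃ ∉ (⊥ : @IntermediateField ℚ (AlgebraicClosure ℚ) _ _ (AlgebraicClosure.instAlgebra ℚ)) := by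
    intro h
    rw [IntermediateField.mem_bot] at h
    obtain ⟨q, hq⟩ := h
    set φ := @algebraMap ℚ (AlgebraicClosure ℚ) _ _ (AlgebraicClosure.instAlgebra ℚ) with hφ
    have hq3 : q ^ 3 = 1 := by
      have h1 : φ (q ^ 3) = φ 1 := by rw [map_pow, hq, hζ₃.pow_eq_one, map_one]
      exact φ.injective h1
    have hq1 : q = 1 := by
      have hodd : Odd 3 := by decide
      exact (Odd.strictMono_pow hodd).injective (by simp only [one_pow]; exact hq3)
    exact hζ₃.ne_one (by norm_num) (by rw [← hq, hq1, map_one])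
  -- hence a mover `ρ ∈ Γ_ℚ`
  have hmover : ∃ f : AlgebraicClosure ℚ ≃ₐ[ℚ] AlgebraicClosure ℚ, f ζ₃ ≠ ζ₃ := by
    by_contra hall
    push Not at hall
    apply hnotbot
    have hmem : ζ₃ ∈ IntermediateField.fixedField
        ((⊥ : @IntermediateField ℚ (AlgebraicClosure ℚ) _ _ (AlgebraicClosure.instAlgebra ℚ)).fixingSubgroup) := by
      rw [IntermediateField.mem_fixedField_iff]
      exact fun f _ => hall f
    rwa [InfiniteGalois.fixedField_fixingSubgroup] at hmem
  obtain ⟨f, hf⟩ := hmover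
  set ρ : absoluteGaloisGroup ℚ := (absoluteGaloisGroup.toAlgEquiv ℚ).symm f with hρ
  have hρζ : ρ • ζ₃ ≠ ζ₃ := by
    rw [absoluteGaloisGroup.smul_def, hρ, MulEquiv.apply_symm_apply]
    exact hf
  -- twist into `Gal(ℚ̄/ℚ_N)`
  have isUnit_two_padicInt_three : IsUnit (2 : ℤ_[3]) := by
    rw [PadicInt.isUnit_iff]
    refine le_antisymm (PadicInt.norm_le_one _) (not_lt.mp fun h => ?_)
    have h' := (PadicInt.norm_int_lt_one_iff_dvd (p := 3) 2).mp (by exact_mod_cast h)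
    omega
  obtain ⟨u, hu⟩ := isUnit_two_padicInt_three
  obtain ⟨σ₁, hσ₁⟩ := κ₃.surjective
    (Multiplicative.ofAdd (-((↑u⁻¹ : ℤ_[3]) * Multiplicative.toAdd (κ₃ ρ))))
  have hσ₁' : κ₃ σ₁ = Multiplicative.ofAdd (-((↑u⁻¹ : ℤ_[3]) * Multiplicative.toAdd (κ₃ ρ))) := hσ₁
  refine ⟨ρ * σ₁ ^ 2, ?_, ?_⟩
  · rw [mem_layerSubgroup, map_mul, map_pow, hσ₁', toAdd_mul, toAdd_pow, toAdd_ofAdd, nsmul_eq_mul]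
    have h2 : ((2 : ℕ) : ℤ_[3]) = (u : ℤ_[3]) := by rw [hu]; norm_num
    have : Multiplicative.toAdd (κ₃ ρ) + ((2 : ℕ) : ℤ_[3]) * -((↑u⁻¹ : ℤ_[3]) * Multiplicative.toAdd (κ₃ ρ)) = 0 := by
      rw [h2, mul_neg, ← mul_assoc, Units.mul_inv, one_mul, add_neg_cancel]
    rw [this]
    exact dvd_zero _
  · rw [mul_smul, sq_smul_zeta_three hζ₃ σ₁]
    exact hρζ

end Literature.NumberTheory.EllipticCurves.ZpExtension

end
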